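import Summits.CriticalPhenomena.SAWScalingLimit.Theorems.SAWTotalPositivityCriticalBubbleBoundKestenDefs
import Literature.Probability.RandomPlanarGeometry.SAWTiles
import HarnessLib

/-!
# Madras–Slade Proposition 8.1.2 for `ℤ²`: up-first arches are fewer than transversally pinned bridges

Stub B `ms_upArch_le_pinnedBridges` of the line `kesten-product-renewal-dictionary` for the crux
`SAWTotalPositivity.CriticalBubbleBound` (stmt-CriticalPhenomena-7117), c5 programme "Madras–Slade §8.1
for `ℤ²`" (`α_sing ≤ 3/2`): the geometric half of "polygons are fewer than pinned bridges".

For every `n`, the `n`-step self-avoiding walks `ω : 0 → e₀ = (1,0)` of `ℤ²` (function model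
`Zd.sawFun 2 n e₀`, frozen at `e₀` after time `n`) with first step `ω 1 = eUp = (0,1)` and all heights
`ω j 1 ≥ 0` (`j ≤ n`) are at most as many as the `(n+1)`-step bridges `ζ` of `ℤ²` (tree convention
`Zd.IsBridge`: coordinate `0` is the bridge direction) whose endpoint has transversal coordinate
`ζ (n+1) 1 = 1`.

The map (Madras–Slade 1993, proof of Proposition 8.1.2): let `M` be the maximal height of `ω` on
`[0, n]` and `s` the LAST time it is attained (`ms812_exists_lastMax`); keep `ω` up to time `s` and
reflect `ω[s, n]` in the horizontal line `y = M` (new heights `g j = ω j 1` for `j ≤ s`,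
`g j = 2M - ω j 1` for `j > s`), prepend the unit step `0 → (0,1)` and swap the two coordinates:
`ζ 0 = 0`, `ζ (k+1) = (1 + g k, ω k 0)`.  Heights `1 + g k` lie in `[1, 2M+1]` and the endpoint is
`(2M+1, 1)` (because `ω n = e₀`), so `ζ` is a bridge with `ζ (n+1) 1 = 1` (`ms812_encode_mem`); and `ω`
is read off `ζ` (`ms812_decode`: `ω i = (ζ (i+1) 1, ζ (i+1) 0 - 1)` or its mirror image according as
`2 (ζ (i+1) 0 - 1) ≤ ζ (n+1) 0 - 1` or not), so the map is injective and
`Finset.card_le_card_of_injOn` concludes (`ms_upArch_le_pinnedBridges`).  No top-level definitions: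
the map is an explicit lambda, `M` and `s` are chosen pointwise (`choose`); adjacency of `ℤ²` in
coordinates is `SAW.adj_iff_coord` (`Literature/Probability/RandomPlanarGeometry/SAWTiles.lean`).

Source: N. Madras, G. Slade, *The Self-Avoiding Walk* (1993), §8.1, Proposition 8.1.2 (p. 262).
-/

noncomputable section

open Literature.Probability.LatticeModels Literature.Probability.RandomPlanarGeometry Literature.Probability.RandomPlanarGeometry.SAW
open Summit.CriticalPhenomena.SAWScalingLimit.Theorems.CriticalBubbleBound.Negative
open Summit.CriticalPhenomena.SAWScalingLimit.Theorems.CriticalBubbleBound.Kesten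
open scoped ENNReal NNReal BigOperators
open Classical

namespace Summit.CriticalPhenomena.SAWScalingLimit.Theorems.CriticalBubbleBound.Kesten.MS

/-! ## The last topmost time -/

/-- For every vertex function `ω` and every `n` there are the maximal height `M = max_{j ≤ n} ω j 1`
and the LAST time `s ≤ n` at which it is attained (heights after `s` are `< M`). [folklore] -/
theorem ms812_exists_lastMax (n : ℕ) (ω : ℕ → Site 2) :
    ∃ M : ℤ, ∃ s : ℕ, s ≤ n ∧ ω s 1 = M ∧ (∀ j ≤ n, ω j 1 ≤ M) ∧
      ∀ j, s < j → j ≤ n → ω j 1 < M := by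
  obtain ⟨j₀, hj₀, hmax⟩ := Finset.exists_max_image (Finset.range (n + 1)) (fun j => ω j 1)
    Finset.nonempty_range_add_one
  have hle : ∀ j ≤ n, ω j 1 ≤ ω j₀ 1 := fun j hj =>
    hmax j (Finset.mem_range.2 (Nat.lt_succ_of_le hj))
  refine ⟨ω j₀ 1, Nat.findGreatest (fun j => ω j 1 = ω j₀ 1) n, Nat.findGreatest_le n,
    Nat.findGreatest_spec (P := fun j => ω j 1 = ω j₀ 1)
      (Nat.le_of_lt_succ (Finset.mem_range.1 hj₀)) rfl, hle, fun j h1 h2 => ?_⟩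
  exact lt_of_le_of_ne (hle j h2)
    (Nat.findGreatest_is_greatest (P := fun j => ω j 1 = ω j₀ 1) h1 h2)

/-! ## The image is a transversally pinned bridge -/

/-- **Madras–Slade Proposition 8.1.2, the map lands in bridges.** Let `ω` be an `n`-step self-avoiding
walk `0 → e₀` of `ℤ²` with non-negative heights on `[0, n]`, `M` its maximal height, `s ≤ n` the last
time `M` is attained, and `g` the reflected height profile (`g j = ω j 1` for `j ≤ s`, `g j = 2M - ω j 1`
for `j > s`). Then `ζ 0 = 0`, `ζ (k+1) = (1 + g k, ω k 0)` is an `(n+1)`-step bridge of `ℤ²` with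
`ζ (n+1) 1 = 1`. [cite: MadrasSlade1993, Proposition 8.1.2] -/
theorem ms812_encode_mem {n : ℕ} {ω : ℕ → Site 2} {M : ℤ} {s : ℕ} {g : ℕ → ℤ}
    (hω : ω ∈ (Zd.sawFun 2 n e₀).filter (fun ω => ω 1 = eUp ∧ ∀ j ≤ n, 0 ≤ ω j 1))
    (hsn : s ≤ n) (hsM : ω s 1 = M) (hle : ∀ j ≤ n, ω j 1 ≤ M)
    (hlt : ∀ j, s < j → j ≤ n → ω j 1 < M)
    (hg1 : ∀ j ≤ s, g j = ω j 1) (hg2 : ∀ j, s < j → g j = 2 * M - ω j 1)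
    (ζ : ℕ → Site 2)
    (hζ : ζ = fun k : ℕ => if k = 0 then (0 : Site 2) else ![1 + g (k - 1), ω (k - 1) 0]) :
    ζ ∈ (Zd.bridges 2 (n + 1)).filter (fun ζ => ζ (n + 1) 1 = 1) := by
  obtain ⟨hωs, -, hnn⟩ := Finset.mem_filter.1 hω
  obtain ⟨h0, hend, hadj, hinj⟩ := Zd.mem_sawFun.1 hωs
  -- values of `ζ`
  have hζ0 : ζ 0 = 0 := by subst hζ; exact if_pos rfl
  have hζs : ∀ k, ζ (k + 1) = ![1 + g k, ω k 0] := fun k => by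
    subst hζ
    show (if k + 1 = 0 then (0 : Site 2) else ![1 + g (k + 1 - 1), ω (k + 1 - 1) 0]) = _
    rw [if_neg (by omega), Nat.add_sub_cancel]
  clear hζ
  -- the reflected height profile
  have hg2' : ∀ j, s ≤ j → g j = 2 * M - ω j 1 := by
    intro j hj
    rcases hj.lt_or_eq with hj | rfl
    · exact hg2 j hj
    · rw [hg1 s le_rfl, hsM]; ring
  have hn1 : ω n 1 = 0 := by rw [hend n le_rfl]; rfl
  have hn0 : ω n 0 = 1 := by rw [hend n le_rfl]; rfl
  have hgn : g n = 2 * M := by rw [hg2' n hsn, hn1, sub_zero]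
  have hg0 : g 0 = 0 := by rw [hg1 0 (Nat.zero_le s), h0]; rfl
  have hgnn : ∀ j ≤ n, 0 ≤ g j := by
    intro j hj
    have := hnn j hj
    rcases le_or_gt j s with hjs | hjs
    · rw [hg1 j hjs]; exact this
    · rw [hg2 j hjs]; have := hlt j hjs hj; omega
  have hgle : ∀ j ≤ n, g j ≤ 2 * M := by
    intro j hj
    have := hnn j hj
    rcases le_or_gt j s with hjs | hjs
    · rw [hg1 j hjs]; have := hle j hj; omega
    · rw [hg2 j hjs]; omega
  refine Finset.mem_filter.2 ⟨Zd.mem_bridges.2 ⟨Zd.mem_saws.2 ⟨hζ0, ?_, ?_, ?_⟩, ?_⟩, ?_⟩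
  · -- frozen from time `n + 1` on
    intro i hi
    obtain ⟨k, rfl⟩ : ∃ k, i = k + 1 := ⟨i - 1, by omega⟩
    rw [hζs, hζs, hg2' k (by omega), hgn, hend k (by omega), hn0]
    simp [e₀]
  · -- nearest-neighbour steps
    intro i hi
    rcases Nat.eq_zero_or_pos i with rfl | hpos
    · rw [hζ0, hζs, hg0, h0, adj_iff_coord]
      simp
    · obtain ⟨k, rfl⟩ : ∃ k, i = k + 1 := ⟨i - 1, by omega⟩
      have ha := (adj_iff_coord _ _).1 (hadj k (by omega))
      rw [hζs, hζs, adj_iff_coord]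
      simp only [Matrix.cons_val_zero, Matrix.cons_val_one]
      rcases le_or_gt (k + 1) s with hks | hks
      · rw [hg1 k (by omega), hg1 (k + 1) hks]; omega
      · rw [hg2' k (by omega), hg2 (k + 1) hks]; omega
  · -- no repeated vertex on `[0, n + 1]`
    intro i hi j hj hij
    simp only [Set.mem_setOf_eq] at hi hj
    rcases Nat.eq_zero_or_pos i with rfl | hipos <;> rcases Nat.eq_zero_or_pos j with rfl | hjpos
    · rfl
    · exfalso
      obtain ⟨b, rfl⟩ : ∃ b, j = b + 1 := ⟨j - 1, by omega⟩
      have e0 := congrFun hij 0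
      rw [hζ0, hζs] at e0
      simp only [Pi.zero_apply, Matrix.cons_val_zero] at e0
      have := hgnn b (by omega); omega
    · exfalso
      obtain ⟨a, rfl⟩ : ∃ a, i = a + 1 := ⟨i - 1, by omega⟩
      have e0 := congrFun hij 0
      rw [hζ0, hζs] at e0
      simp only [Pi.zero_apply, Matrix.cons_val_zero] at e0
      have := hgnn a (by omega); omega
    · obtain ⟨a, rfl⟩ : ∃ a, i = a + 1 := ⟨i - 1, by omega⟩
      obtain ⟨b, rfl⟩ : ∃ b, j = b + 1 := ⟨j - 1, by omega⟩
      have e0 := congrFun hij 0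
      have e1 := congrFun hij 1
      rw [hζs, hζs] at e0 e1
      simp only [Matrix.cons_val_zero, add_right_inj] at e0
      simp only [Matrix.cons_val_one, Matrix.cons_val_zero] at e1
      have hab : ω a 1 = ω b 1 := by
        rcases le_or_gt a s with has | has <;> rcases le_or_gt b s with hbs | hbs
        · rwa [hg1 a has, hg1 b hbs] at e0
        · rw [hg1 a has, hg2 b hbs] at e0
          have := hle a (by omega); have := hlt b hbs (by omega); omega
        · rw [hg2 a has, hg1 b hbs] at e0
          have := hle b (by omega); have := hlt a has (by omega); omega
        · rw [hg2 a has, hg2 b hbs] at e0; omega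
      have hωab : ω a = ω b := by
        funext l
        fin_cases l
        · exact e1
        · exact hab
      rw [hinj (show a ≤ n by omega) (show b ≤ n by omega) hωab]
  · -- bridge: `0 = ζ 0 0 < ζ i 0 ≤ ζ (n+1) 0 = 2M + 1`
    intro i h1i hi
    obtain ⟨k, rfl⟩ : ∃ k, i = k + 1 := ⟨i - 1, by omega⟩
    have := hgnn k (by omega)
    have := hgle k (by omega)
    rw [hζ0, hζs, hζs, hgn]
    simp only [Pi.zero_apply, Matrix.cons_val_zero]
    exact ⟨by omega, by omega⟩
  · -- transversal coordinate of the endpoint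
    show ζ (n + 1) 1 = 1
    rw [hζs]
    simp only [Matrix.cons_val_one, Matrix.cons_val_zero]
    exact hn0

/-! ## Decoding, injectivity, the count -/

/-- **Madras–Slade Proposition 8.1.2, the map is injective**: with the notation of `ms812_encode_mem`,
`ω` is read off `ζ`: `2M = ζ (n+1) 0 - 1`, and `ω i` is `(ζ (i+1) 1, ζ (i+1) 0 - 1)` when twice that
height is at most `2M` (times `i ≤ s`, and the frozen tail when `M = 0`) and its mirror image
`(ζ (i+1) 1, 2M - (ζ (i+1) 0 - 1))` otherwise. [cite: MadrasSlade1993, Proposition 8.1.2] -/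
theorem ms812_decode {n : ℕ} {ω : ℕ → Site 2} {M : ℤ} {s : ℕ} {g : ℕ → ℤ}
    (hω : ω ∈ (Zd.sawFun 2 n e₀).filter (fun ω => ω 1 = eUp ∧ ∀ j ≤ n, 0 ≤ ω j 1))
    (hsn : s ≤ n) (hsM : ω s 1 = M) (hle : ∀ j ≤ n, ω j 1 ≤ M)
    (hlt : ∀ j, s < j → j ≤ n → ω j 1 < M)
    (hg1 : ∀ j ≤ s, g j = ω j 1) (hg2 : ∀ j, s < j → g j = 2 * M - ω j 1)
    (ζ : ℕ → Site 2)
    (hζ : ζ = fun k : ℕ => if k = 0 then (0 : Site 2) else ![1 + g (k - 1), ω (k - 1) 0]) :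
    ω = fun i => if 2 * (ζ (i + 1) 0 - 1) ≤ ζ (n + 1) 0 - 1 then ![ζ (i + 1) 1, ζ (i + 1) 0 - 1]
      else ![ζ (i + 1) 1, ζ (n + 1) 0 - ζ (i + 1) 0] := by
  obtain ⟨hωs, -, hnn⟩ := Finset.mem_filter.1 hω
  obtain ⟨h0, hend, -, -⟩ := Zd.mem_sawFun.1 hωs
  have hζs : ∀ k, ζ (k + 1) = ![1 + g k, ω k 0] := fun k => by
    subst hζ
    show (if k + 1 = 0 then (0 : Site 2) else ![1 + g (k + 1 - 1), ω (k + 1 - 1) 0]) = _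
    rw [if_neg (by omega), Nat.add_sub_cancel]
  clear hζ
  have hg2' : ∀ j, s ≤ j → g j = 2 * M - ω j 1 := by
    intro j hj
    rcases hj.lt_or_eq with hj | rfl
    · exact hg2 j hj
    · rw [hg1 s le_rfl, hsM]; ring
  have hn1 : ω n 1 = 0 := by rw [hend n le_rfl]; rfl
  have hM0 : 0 ≤ M := by have := hle 0 (Nat.zero_le n); rw [h0] at this; exact this
  funext i
  have key : ∀ t : ℤ, t = ω i 1 → ω i = ![ω i 0, t] := by
    rintro t rfl
    funext l
    fin_cases l
    · rfl
    · rfl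
  rw [hζs, hζs, hg2' n hsn, hn1]
  simp only [Matrix.cons_val_zero, Matrix.cons_val_one]
  rcases le_or_gt i s with his | his
  · have hgi := hg1 i his
    have := hle i (his.trans hsn)
    split_ifs with hc
    · exact key _ (by omega)
    · exfalso; omega
  · rcases le_or_gt i n with hin | hin
    · have hgi := hg2 i his
      have := hlt i his hin
      split_ifs with hc
      · exfalso; omega
      · exact key _ (by omega)
    · have hgi := hg2 i his
      have hi1 : ω i 1 = 0 := by rw [hend i hin.le]; rfl
      have := hnn 0 (Nat.zero_le n)
      split_ifs with hc
      · exact key _ (by omega)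
      · exact key _ (by omega)

/-- **Madras–Slade Proposition 8.1.2 for `ℤ²`** ("polygons are fewer than transversally pinned bridges",
geometric half): the `n`-step self-avoiding walks `0 → e₀` of `ℤ²` with first step `(0,1)` staying in the
upper half-plane `{y ≥ 0}` are at most as many as the `(n+1)`-step bridges whose endpoint has transversal
coordinate `1` — reflect the walk after its last topmost vertex in the horizontal line through it, prepend
a unit step and swap the coordinates; the map is injective. [cite: MadrasSlade1993, Proposition 8.1.2] -/
theorem ms_upArch_le_pinnedBridges : ∀ n : ℕ, ((Zd.sawFun 2 n e₀).filter (fun ω => ω 1 = eUp ∧ ∀ j ≤ n, 0 ≤ ω j 1)).card ≤ ((Zd.bridges 2 (n + 1)).filter (fun ζ => ζ (n + 1) 1 = 1)).card := by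
  intro n
  choose M s hsn hsM hle hlt using ms812_exists_lastMax n
  refine Finset.card_le_card_of_injOn
    (fun ω k => if k = 0 then (0 : Site 2) else
      ![1 + (if k - 1 ≤ s ω then ω (k - 1) 1 else 2 * M ω - ω (k - 1) 1), ω (k - 1) 0]) ?_ ?_
  · intro ω hω
    exact Finset.mem_coe.2 (ms812_encode_mem
      (g := fun j => if j ≤ s ω then ω j 1 else 2 * M ω - ω j 1) (Finset.mem_coe.1 hω) (hsn ω)
      (hsM ω) (hle ω) (hlt ω) (fun j hj => if_pos hj) (fun j hj => if_neg (not_le.2 hj)) _ rfl)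
  · intro ω hω ω' hω' h
    have h1 := ms812_decode (g := fun j => if j ≤ s ω then ω j 1 else 2 * M ω - ω j 1)
      (Finset.mem_coe.1 hω) (hsn ω) (hsM ω) (hle ω) (hlt ω) (fun j hj => if_pos hj)
      (fun j hj => if_neg (not_le.2 hj)) _ rfl
    have h2 := ms812_decode (g := fun j => if j ≤ s ω' then ω' j 1 else 2 * M ω' - ω' j 1)
      (Finset.mem_coe.1 hω') (hsn ω') (hsM ω') (hle ω') (hlt ω') (fun j hj => if_pos hj)
      (fun j hj => if_neg (not_le.2 hj)) _ h
    exact h1.trans h2.symm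

end Summit.CriticalPhenomena.SAWScalingLimit.Theorems.CriticalBubbleBound.Kesten.MS

end
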